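import Mathlib
import HarnessLib

/-!
# The two-zone loop: joint decay / joint boundedness of a pair of coupled nonnegative hop recursions
  (helper for item stmt-NavierStokesRegularity-22987 `FlatGapCertificatesV2`, crux K_A♭ of route
  TaoLadderRungTwoFlat; cell harvest/h2-tao-ladder, p1 g21; LADDER §49.5, lemma L8b-4)

Behind a captured pulse two estimates meet at the window edge (theory-1 g37, JUNK-RACE-49 §49.5): the CORE ZONE
(gauge deviation `B_N` after `N` hops, contracting by `ρ` per hop up to inputs from behind) and the BEHIND ZONE
(co-moving deviation energy, amplitude `a_N = √V(s_N)`, decaying by `e^{−μ_θ τ_h/2}` per hop up to inputs from the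
core). In amplitude variables one hop reads
  `a_{N+1} ≤ m₁₁·a_N + m₁₂·B_N + f_N`,   `B_{N+1} ≤ m₂₁·a_N + m₂₂·B_N + g_N`,   `m_ij ≥ 0`.
This file is the ELEMENTARY closing step L8b-4:

* `exists_contracting_weights` — the spectral-radius test for a nonnegative `2×2` matrix: `m₁₁ < 1`, `m₂₂ < 1`
  and `m₁₂·m₂₁ < (1−m₁₁)(1−m₂₂)` give weights `w₁, w₂ > 0` and a factor `0 ≤ λ < 1` with
  `w₁m₁₁ + w₂m₂₁ ≤ λw₁`, `w₁m₁₂ + w₂m₂₂ ≤ λw₂` (a joint Lyapunov functional `L = w₁a + w₂B`);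
* `lyapunov_step` — then `L_{N+1} ≤ λ·L_N + (w₁f_N + w₂g_N)`;
* `le_geom_of_step` — `L_{N+1} ≤ λL_N + c` for all `N` ⇒ `L_N ≤ λ^N·L_0 + c/(1−λ)` (JOINT BOUNDEDNESS: the
  `λ₀ > 1` use, inputs `O(ε₀κ)` per hop), and with `c = 0` joint exponential decay;
* `joint_decay_of_quadratic_inputs` — inputs `f_N, g_N ≤ K·(a_N + B_N)²` (superlinear) ⇒ for `a_0 + B_0 ≤ δ₀` the pair
  decays jointly, `a_N + B_N ≤ C·λ'^N·(a_0 + B_0)` with `δ₀ > 0`, `λ' < 1`, `C` depending on `(m, K)` only (the `λ₀ = 1`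
  use: (WG) "for all `N ≥ N₀`" of SPLIT-T48 child 1).

HONEST FRAMING: elementary real analysis (nonnegative `2×2` recursions); nothing specific to any lattice is asserted;
nothing about the Navier–Stokes equations.
-/

noncomputable section

-- the sub-problem namespace repeats the summit name by design (D-0017)
set_option linter.dupNamespace false

namespace Summit.NavierStokesRegularity.NavierStokesRegularity.Theorems

namespace TwoZoneLoop

/-- **Spectral-radius test for a nonnegative `2×2` matrix, in Lyapunov form.** If `0 ≤ m₁₁, m₁₂, m₂₁`, `m₁₁ < 1`,
`m₂₂ < 1` and `m₁₂·m₂₁ < (1 − m₁₁)(1 − m₂₂)` then there are weights `w₁, w₂ > 0` and `λ ∈ [0,1)` with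
`w₁m₁₁ + w₂m₂₁ ≤ λw₁` and `w₁m₁₂ + w₂m₂₂ ≤ λw₂` (i.e. `wᵀM ≤ λwᵀ`). [folklore] -/
theorem exists_contracting_weights {m₁₁ m₁₂ m₂₁ m₂₂ : ℝ} (h₁₁ : 0 ≤ m₁₁) (h₁₂ : 0 ≤ m₁₂) (h₂₁ : 0 ≤ m₂₁)
    (h₁ : m₁₁ < 1) (h₂ : m₂₂ < 1) (hdet : m₁₂ * m₂₁ < (1 - m₁₁) * (1 - m₂₂)) :
    ∃ lam w₁ w₂ : ℝ, 0 ≤ lam ∧ lam < 1 ∧ 0 < w₁ ∧ 0 < w₂ ∧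
      w₁ * m₁₁ + w₂ * m₂₁ ≤ lam * w₁ ∧ w₁ * m₁₂ + w₂ * m₂₂ ≤ lam * w₂ := by
  -- the gap of the determinant test and a margin η with (1−η−m₁₁)(1−η−m₂₂) > m₁₂ m₂₁
  set gap : ℝ := (1 - m₁₁) * (1 - m₂₂) - m₁₂ * m₂₁ with hgap_def
  have hgap : 0 < gap := by rw [hgap_def]; linarith
  have hS : 0 < 2 - m₁₁ - m₂₂ := by linarith
  set η : ℝ := min (gap / (2 * (2 - m₁₁ - m₂₂))) (min ((1 - m₁₁) / 2) ((1 - m₂₂) / 2)) with hη_def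
  have hη_pos : 0 < η := by
    rw [hη_def]
    refine lt_min (div_pos hgap (by linarith)) (lt_min (by linarith) (by linarith))
  have hη₁ : η ≤ (1 - m₁₁) / 2 := (min_le_right _ _).trans (min_le_left _ _)
  have hη₂ : η ≤ (1 - m₂₂) / 2 := (min_le_right _ _).trans (min_le_right _ _)
  have hηg : η ≤ gap / (2 * (2 - m₁₁ - m₂₂)) := min_le_left _ _
  have hηg' : η * (2 - m₁₁ - m₂₂) ≤ gap / 2 := by
    have := mul_le_mul_of_nonneg_right hηg hS.le
    calc η * (2 - m₁₁ - m₂₂) ≤ gap / (2 * (2 - m₁₁ - m₂₂)) * (2 - m₁₁ - m₂₂) := this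
      _ = gap / 2 := by field_simp
  set lam : ℝ := 1 - η with hlam_def
  have hA : 0 < lam - m₁₁ := by rw [hlam_def]; linarith
  have hD : 0 < lam - m₂₂ := by rw [hlam_def]; linarith
  -- (λ − m₁₁)(λ − m₂₂) ≥ (1−m₁₁)(1−m₂₂) − η(2 − m₁₁ − m₂₂) ≥ m₁₂m₂₁ + gap/2
  have hprod : m₁₂ * m₂₁ + gap / 2 ≤ (lam - m₁₁) * (lam - m₂₂) := by
    have hexp : (lam - m₁₁) * (lam - m₂₂) = (1 - m₁₁) * (1 - m₂₂) - η * (2 - m₁₁ - m₂₂) + η ^ 2 := by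
      rw [hlam_def]; ring
    rw [hexp]
    nlinarith [sq_nonneg η]
  -- weights: w₁ = 1, w₂ = (m₁₂ + δ') / (λ − m₂₂) with δ' = (gap/2) / (m₂₁ + 1)
  set δ' : ℝ := gap / 2 / (m₂₁ + 1) with hδ'_def
  have hδ'_pos : 0 < δ' := by rw [hδ'_def]; positivity
  have hδ'm : δ' * m₂₁ ≤ gap / 2 := by
    rw [hδ'_def, div_mul_eq_mul_div, div_le_iff₀ (by linarith)]
    nlinarith
  refine ⟨lam, 1, (m₁₂ + δ') / (lam - m₂₂), ?_, ?_, one_pos, ?_, ?_, ?_⟩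
  · rw [hlam_def]; linarith
  · rw [hlam_def]; linarith
  · exact div_pos (by linarith) hD
  · -- m₁₁ + w₂ m₂₁ ≤ λ  ⟸  (m₁₂ + δ') m₂₁ ≤ (λ − m₁₁)(λ − m₂₂)
    rw [one_mul, mul_one, div_mul_eq_mul_div, ← sub_nonneg]
    have key : (m₁₂ + δ') * m₂₁ ≤ (lam - m₁₁) * (lam - m₂₂) := by nlinarith
    have : lam - (m₁₁ + (m₁₂ + δ') * m₂₁ / (lam - m₂₂))
        = ((lam - m₁₁) * (lam - m₂₂) - (m₁₂ + δ') * m₂₁) / (lam - m₂₂) := by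
      field_simp
      ring
    rw [show lam - (m₁₁ + (m₁₂ + δ') * m₂₁ / (lam - m₂₂))
        = lam - (m₁₁ + (m₁₂ + δ') * m₂₁ / (lam - m₂₂)) from rfl] at this
    have hnn : 0 ≤ ((lam - m₁₁) * (lam - m₂₂) - (m₁₂ + δ') * m₂₁) / (lam - m₂₂) :=
      div_nonneg (by linarith) hD.le
    linarith [this, hnn]
  · -- m₁₂ + w₂ m₂₂ ≤ λ w₂  ⟺  m₁₂ ≤ (λ − m₂₂) w₂ = m₁₂ + δ'
    rw [one_mul]
    have hw : (lam - m₂₂) * ((m₁₂ + δ') / (lam - m₂₂)) = m₁₂ + δ' := by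
      field_simp
    nlinarith [hw, hδ'_pos]

/-- **One step of the joint Lyapunov functional.** With weights as in `exists_contracting_weights` and
nonnegative states, the coupled recursion contracts `L = w₁a + w₂B` by `λ` up to the weighted inputs. [folklore] -/
theorem lyapunov_step {m₁₁ m₁₂ m₂₁ m₂₂ lam w₁ w₂ a B a' B' f g : ℝ} (hw₁ : 0 ≤ w₁) (hw₂ : 0 ≤ w₂)
    (hr₁ : w₁ * m₁₁ + w₂ * m₂₁ ≤ lam * w₁) (hr₂ : w₁ * m₁₂ + w₂ * m₂₂ ≤ lam * w₂) (ha : 0 ≤ a) (hB : 0 ≤ B)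
    (h₁ : a' ≤ m₁₁ * a + m₁₂ * B + f) (h₂ : B' ≤ m₂₁ * a + m₂₂ * B + g) :
    w₁ * a' + w₂ * B' ≤ lam * (w₁ * a + w₂ * B) + (w₁ * f + w₂ * g) := by
  have e1 := mul_le_mul_of_nonneg_left h₁ hw₁
  have e2 := mul_le_mul_of_nonneg_left h₂ hw₂
  have e3 := mul_le_mul_of_nonneg_right hr₁ ha
  have e4 := mul_le_mul_of_nonneg_right hr₂ hB
  nlinarith

/-- **Discrete Gronwall, geometric form.** `0 ≤ λ < 1`, `L_{N+1} ≤ λL_N + c` for all `N` ⇒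
`L_N ≤ λ^N·L_0 + c/(1−λ)` (JOINT BOUNDEDNESS of the two zones under bounded per-hop inputs; with `c = 0`, JOINT
EXPONENTIAL DECAY). [folklore] -/
theorem le_geom_of_step {lam c : ℝ} (hlam : 0 ≤ lam) (hlam1 : lam < 1) (hc : 0 ≤ c) {L : ℕ → ℝ}
    (hstep : ∀ N, L (N + 1) ≤ lam * L N + c) (N : ℕ) : L N ≤ lam ^ N * L 0 + c / (1 - lam) := by
  induction N with
  | zero =>
    have : 0 ≤ c / (1 - lam) := div_nonneg hc (by linarith)
    simpa using this
  | succ N ih =>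
    have h1 := hstep N
    have h2 : lam * L N ≤ lam * (lam ^ N * L 0 + c / (1 - lam)) := mul_le_mul_of_nonneg_left ih hlam
    have hne : (1 - lam) ≠ 0 := ne_of_gt (sub_pos.mpr hlam1)
    have h3 : lam * (c / (1 - lam)) + c = c / (1 - lam) := by
      field_simp
      ring
    calc L (N + 1) ≤ lam * (lam ^ N * L 0 + c / (1 - lam)) + c := h1.trans (by linarith)
      _ = lam ^ (N + 1) * L 0 + (lam * (c / (1 - lam)) + c) := by ring
      _ = lam ^ (N + 1) * L 0 + c / (1 - lam) := by rw [h3]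

/-- `le_geom_of_step` with `c = 0`: `L_{N+1} ≤ λL_N` for all `N` ⇒ `L_N ≤ λ^N L_0`. [folklore] -/
theorem le_pow_mul_of_step {lam : ℝ} (hlam : 0 ≤ lam) (hlam1 : lam < 1) {L : ℕ → ℝ}
    (hstep : ∀ N, L (N + 1) ≤ lam * L N) (N : ℕ) : L N ≤ lam ^ N * L 0 := by
  have h := le_geom_of_step hlam hlam1 le_rfl (L := L) (fun N => by simpa using hstep N) N
  simpa using h

/-- **Joint boundedness of the two-zone loop (the `λ₀ > 1` use).** Nonnegative sequences with
`a_{N+1} ≤ m₁₁a_N + m₁₂B_N + f_N`, `B_{N+1} ≤ m₂₁a_N + m₂₂B_N + g_N`, inputs `f_N ≤ F`, `g_N ≤ G` (`F, G ≥ 0`)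
and a matrix passing the spectral test: both zones stay bounded,
`w₁a_N + w₂B_N ≤ λ^N(w₁a_0 + w₂B_0) + (w₁F + w₂G)/(1−λ)` — uniformly in `N`. [folklore] -/
theorem jointly_bounded {m₁₁ m₁₂ m₂₁ m₂₂ F G : ℝ} (h₁₁ : 0 ≤ m₁₁) (h₁₂ : 0 ≤ m₁₂) (h₂₁ : 0 ≤ m₂₁)
    (h₁ : m₁₁ < 1) (h₂ : m₂₂ < 1) (hdet : m₁₂ * m₂₁ < (1 - m₁₁) * (1 - m₂₂)) (hF : 0 ≤ F)
    (hG : 0 ≤ G) :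
    ∃ lam w₁ w₂ : ℝ, 0 ≤ lam ∧ lam < 1 ∧ 0 < w₁ ∧ 0 < w₂ ∧
      ∀ (a B f g : ℕ → ℝ), (∀ N, 0 ≤ a N) → (∀ N, 0 ≤ B N) → (∀ N, f N ≤ F) → (∀ N, g N ≤ G) →
        (∀ N, a (N + 1) ≤ m₁₁ * a N + m₁₂ * B N + f N) → (∀ N, B (N + 1) ≤ m₂₁ * a N + m₂₂ * B N + g N) →
        ∀ N, w₁ * a N + w₂ * B N ≤ lam ^ N * (w₁ * a 0 + w₂ * B 0) + (w₁ * F + w₂ * G) / (1 - lam) := by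
  obtain ⟨lam, w₁, w₂, hl0, hl1, hw₁, hw₂, hr₁, hr₂⟩ :=
    exists_contracting_weights h₁₁ h₁₂ h₂₁ h₁ h₂ hdet
  refine ⟨lam, w₁, w₂, hl0, hl1, hw₁, hw₂, fun a B f g ha hB hf hg hra hrB N => ?_⟩
  refine le_geom_of_step hl0 hl1 (by positivity) (L := fun N => w₁ * a N + w₂ * B N) (fun K => ?_) N
  have hs := lyapunov_step hw₁.le hw₂.le hr₁ hr₂ (ha K) (hB K) (hra K) (hrB K)
  have : w₁ * f K + w₂ * g K ≤ w₁ * F + w₂ * G := by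
    have := mul_le_mul_of_nonneg_left (hf K) hw₁.le
    have := mul_le_mul_of_nonneg_left (hg K) hw₂.le
    linarith
  simpa using hs.trans (by linarith)

/-- **Scalar quadratic step.** `0 ≤ λ < 1`, `0 ≤ K'`, `0 ≤ L_N`, `L_{N+1} ≤ λL_N + K'L_N²` and
`L_0 ≤ (1−λ)/(2(K'+1))` ⇒ `L_N ≤ ((1+λ)/2)^N·L_0` for all `N` (smallness is preserved and the quadratic term eats at
most half the margin). [folklore] -/
theorem le_pow_of_quadratic_step {lam K' : ℝ} (hlam : 0 ≤ lam) (hlam1 : lam < 1) (hK' : 0 ≤ K') {L : ℕ → ℝ}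
    (hnn : ∀ N, 0 ≤ L N) (hstep : ∀ N, L (N + 1) ≤ lam * L N + K' * L N ^ 2)
    (h0 : L 0 ≤ (1 - lam) / (2 * (K' + 1))) (N : ℕ) : L N ≤ ((1 + lam) / 2) ^ N * L 0 := by
  have hKL₀ : K' * ((1 - lam) / (2 * (K' + 1))) ≤ (1 - lam) / 2 := by
    have : K' * ((1 - lam) / (2 * (K' + 1))) = (1 - lam) / 2 * (K' / (K' + 1)) := by
      field_simp
    rw [this]
    have hle : K' / (K' + 1) ≤ 1 := by rw [div_le_one (by positivity)]; linarith
    exact mul_le_of_le_one_right (by linarith) hle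
  have hinv : ∀ N, L N ≤ (1 - lam) / (2 * (K' + 1)) ∧ L N ≤ ((1 + lam) / 2) ^ N * L 0 := by
    intro N
    induction N with
    | zero => exact ⟨h0, by simp⟩
    | succ N ih =>
      obtain ⟨ihs, ihd⟩ := ih
      have hKL : K' * L N ≤ (1 - lam) / 2 := (mul_le_mul_of_nonneg_left ihs hK').trans hKL₀
      have h2 : K' * L N ^ 2 ≤ (1 - lam) / 2 * L N := by
        have h := mul_le_mul_of_nonneg_right hKL (hnn N)
        calc K' * L N ^ 2 = K' * L N * L N := by ring
          _ ≤ (1 - lam) / 2 * L N := h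
      have hcontr : L (N + 1) ≤ (1 + lam) / 2 * L N := by
        have h1 := hstep N
        have : lam * L N + (1 - lam) / 2 * L N = (1 + lam) / 2 * L N := by ring
        linarith
      refine ⟨?_, ?_⟩
      · have h3 : (1 + lam) / 2 * L N ≤ L N := by
          have := hnn N
          nlinarith
        exact hcontr.trans (h3.trans ihs)
      · calc L (N + 1) ≤ (1 + lam) / 2 * L N := hcontr
          _ ≤ (1 + lam) / 2 * (((1 + lam) / 2) ^ N * L 0) :=
              mul_le_mul_of_nonneg_left ihd (by linarith)
          _ = ((1 + lam) / 2) ^ (N + 1) * L 0 := by ring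
  exact (hinv N).2

/-- **Joint exponential decay under superlinear inputs (the `λ₀ = 1` use).** If the per-hop inputs are quadratic
in the joint size, `f_N, g_N ≤ K(a_N + B_N)²`, and the matrix passes the spectral test, then there are `δ₀ > 0`,
`λ' ∈ [0,1)` and `C > 0`, depending on `(m, K)` only, such that every nonnegative solution of the coupled recursion
with `a_0 + B_0 ≤ δ₀` satisfies `a_N + B_N ≤ C·λ'^N·(a_0 + B_0)` for all `N`. [folklore] -/
theorem joint_decay_of_quadratic_inputs {m₁₁ m₁₂ m₂₁ m₂₂ K : ℝ} (h₁₁ : 0 ≤ m₁₁) (h₁₂ : 0 ≤ m₁₂)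
    (h₂₁ : 0 ≤ m₂₁) (h₁ : m₁₁ < 1) (h₂ : m₂₂ < 1)
    (hdet : m₁₂ * m₂₁ < (1 - m₁₁) * (1 - m₂₂)) (hK : 0 ≤ K) :
    ∃ δ₀ lam' C : ℝ, 0 < δ₀ ∧ 0 ≤ lam' ∧ lam' < 1 ∧ 0 < C ∧
      ∀ (a B f g : ℕ → ℝ), (∀ N, 0 ≤ a N) → (∀ N, 0 ≤ B N) →
        (∀ N, f N ≤ K * (a N + B N) ^ 2) → (∀ N, g N ≤ K * (a N + B N) ^ 2) →
        (∀ N, a (N + 1) ≤ m₁₁ * a N + m₁₂ * B N + f N) → (∀ N, B (N + 1) ≤ m₂₁ * a N + m₂₂ * B N + g N) →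
        a 0 + B 0 ≤ δ₀ → ∀ N, a N + B N ≤ C * lam' ^ N * (a 0 + B 0) := by
  obtain ⟨lam, w₁, w₂, hl0, hl1, hw₁, hw₂, hr₁, hr₂⟩ :=
    exists_contracting_weights h₁₁ h₁₂ h₂₁ h₁ h₂ hdet
  -- comparison constants between L = w₁a + w₂B and s = a + B:  wlo·s ≤ L ≤ whi·s
  obtain ⟨wlo, hwlo, hlo₁, hlo₂⟩ : ∃ wlo : ℝ, 0 < wlo ∧ wlo ≤ w₁ ∧ wlo ≤ w₂ :=
    ⟨min w₁ w₂, lt_min hw₁ hw₂, min_le_left _ _, min_le_right _ _⟩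
  obtain ⟨whi, hwhi, hhi₁, hhi₂⟩ : ∃ whi : ℝ, 0 < whi ∧ w₁ ≤ whi ∧ w₂ ≤ whi :=
    ⟨max w₁ w₂, lt_max_of_lt_left hw₁, le_max_left _ _, le_max_right _ _⟩
  -- the quadratic input in L:  w₁f + w₂g ≤ (w₁+w₂)K s² ≤ ((w₁+w₂)K/wlo²)·L² =: K' L²
  set K' : ℝ := (w₁ + w₂) * K / wlo ^ 2 with hK'_def
  have hK' : 0 ≤ K' := by rw [hK'_def]; positivity
  set L₀ : ℝ := (1 - lam) / (2 * (K' + 1)) with hL₀_def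
  have hL₀ : 0 < L₀ := by rw [hL₀_def]; exact div_pos (by linarith) (by positivity)
  refine ⟨L₀ / whi, (1 + lam) / 2, whi / wlo, div_pos hL₀ hwhi, by linarith, by linarith, div_pos hwhi hwlo, ?_⟩
  intro a B f g ha hB hf hg hra hrB hsmall
  -- the functional N ↦ w₁ a N + w₂ B N and its comparison with a + B
  have hLlo : ∀ N, wlo * (a N + B N) ≤ w₁ * a N + w₂ * B N := fun N => by
    have e1 : wlo * a N ≤ w₁ * a N := mul_le_mul_of_nonneg_right hlo₁ (ha N)
    have e2 : wlo * B N ≤ w₂ * B N := mul_le_mul_of_nonneg_right hlo₂ (hB N)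
    linarith
  have hLhi : ∀ N, w₁ * a N + w₂ * B N ≤ whi * (a N + B N) := fun N => by
    have e1 : w₁ * a N ≤ whi * a N := mul_le_mul_of_nonneg_right hhi₁ (ha N)
    have e2 : w₂ * B N ≤ whi * B N := mul_le_mul_of_nonneg_right hhi₂ (hB N)
    linarith
  have hLnn : ∀ N, 0 ≤ w₁ * a N + w₂ * B N := fun N =>
    add_nonneg (mul_nonneg hw₁.le (ha N)) (mul_nonneg hw₂.le (hB N))
  -- one step: L (N+1) ≤ λ L N + K' (L N)²
  have hstep : ∀ N, w₁ * a (N + 1) + w₂ * B (N + 1)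
      ≤ lam * (w₁ * a N + w₂ * B N) + K' * (w₁ * a N + w₂ * B N) ^ 2 := fun N => by
    have hs := lyapunov_step hw₁.le hw₂.le hr₁ hr₂ (ha N) (hB N) (hra N) (hrB N)
    have hin : w₁ * f N + w₂ * g N ≤ K' * (w₁ * a N + w₂ * B N) ^ 2 := by
      have h0 : 0 ≤ a N + B N := add_nonneg (ha N) (hB N)
      have h1 : a N + B N ≤ (w₁ * a N + w₂ * B N) / wlo := by
        rw [le_div_iff₀ hwlo]; linarith [hLlo N]
      have hsq : (a N + B N) ^ 2 ≤ ((w₁ * a N + w₂ * B N) / wlo) ^ 2 := pow_le_pow_left₀ h0 h1 2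
      have e1 := mul_le_mul_of_nonneg_left (hf N) hw₁.le
      have e2 := mul_le_mul_of_nonneg_left (hg N) hw₂.le
      have e3 : (w₁ + w₂) * K * (a N + B N) ^ 2 ≤ (w₁ + w₂) * K * ((w₁ * a N + w₂ * B N) / wlo) ^ 2 :=
        mul_le_mul_of_nonneg_left hsq (by positivity)
      have e4 : (w₁ + w₂) * K * ((w₁ * a N + w₂ * B N) / wlo) ^ 2 = K' * (w₁ * a N + w₂ * B N) ^ 2 := by
        rw [hK'_def]; field_simp
      calc w₁ * f N + w₂ * g N ≤ w₁ * (K * (a N + B N) ^ 2) + w₂ * (K * (a N + B N) ^ 2) := add_le_add e1 e2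
        _ = (w₁ + w₂) * K * (a N + B N) ^ 2 := by ring
        _ ≤ K' * (w₁ * a N + w₂ * B N) ^ 2 := e3.trans_eq e4
    exact hs.trans (by linarith)
  -- smallness at N = 0 and the scalar lemma
  have hL0small : w₁ * a 0 + w₂ * B 0 ≤ L₀ := by
    have h2 : whi * (a 0 + B 0) ≤ whi * (L₀ / whi) := mul_le_mul_of_nonneg_left hsmall hwhi.le
    have h3 : whi * (L₀ / whi) = L₀ := by field_simp
    linarith [hLhi 0]
  have hmain := le_pow_of_quadratic_step hl0 hl1 hK' (L := fun N => w₁ * a N + w₂ * B N) hLnn hstep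
    (by simpa [hL₀_def] using hL0small)
  intro N
  have h1 : wlo * (a N + B N) ≤ ((1 + lam) / 2) ^ N * (w₁ * a 0 + w₂ * B 0) := (hLlo N).trans (hmain N)
  have h2 : ((1 + lam) / 2) ^ N * (w₁ * a 0 + w₂ * B 0) ≤ ((1 + lam) / 2) ^ N * (whi * (a 0 + B 0)) :=
    mul_le_mul_of_nonneg_left (hLhi 0) (pow_nonneg (by linarith) N)
  have h4 : whi / wlo * ((1 + lam) / 2) ^ N * (a 0 + B 0)
      = ((1 + lam) / 2) ^ N * (whi * (a 0 + B 0)) / wlo := by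
    field_simp
  rw [h4, le_div_iff₀ hwlo]
  linarith

end TwoZoneLoop

end Summit.NavierStokesRegularity.NavierStokesRegularity.Theorems

end
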